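import Literature.MathematicalPhysics.QuantumFieldTheory.Balaban1983to89.B3Ineq25Op116CollarRegionHolder
import Literature.MathematicalPhysics.QuantumFieldTheory.Balaban1983to89.B3Ineq25Op116RegularRegion
import Literature.MathematicalPhysics.QuantumFieldTheory.Balaban1983to89.B3Op116ClassCCutoffs
import Literature.MathematicalPhysics.QuantumFieldTheory.Balaban1983to89.B3Op116CollarConst

/-!
# Bałaban, *(Higgs)₂,₃ quantum fields in a finite volume III. Renormalization* [B3] — p. 433 class (c): THE THREE-PIECE SPLIT
`B̃ = B + A + P` OF THE BACKGROUND ON A CELL-PRODUCT BOX `□` BY TWO LATTICE CUTOFFS, ITS BOOKKEEPING, AND — AS ONE THEOREM — PRINT'S PROPAGATOR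
`G_k(□,B̃)` RECOMBINED FROM THE PIECES WITH BOTH (2.5) MEMBERS (collar for `(P, B̃ − P)`, core for `(A, B̃₀)`, explicit constants given before the
configuration) — file «ClassCSplit» of the cell's Route δ (STEP 1 + STEP 2 glue)

statement-level skeleton of published theorems with citation tags; proofs where landed; nothing here is a claim about the Yang–Mills mass gap

T. Bałaban, Commun. Math. Phys. **88** (1983) 411–445 [cite: Balaban1983Higgs3]; part I, Commun. Math. Phys. **85** (1982) 603–636
[cite: Balaban1982Higgs1]; [B4] Commun. Math. Phys. **89** (1983) 571–597 [cite: Balaban1983RegularityDecay].  PDFs held: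
`paper:balaban1983-higgs-2-3-quantum-fields-finite-volume` (journal page = PDF page + 410; p. 412 = `p0002.txt`, p. 414 = `p0004.txt`,
p. 420 = `p0010.txt`, p. 424 = `p0014.txt`, p. 433 = `p0023.txt`).

CITATION HEADER (lean-in-tree rule).  Cell `lit-balaban` (HOME `run/shared/lean/pub/lit-balaban/`), Phase-2 proof seat **p40** gen 78
(unit `lit-balaban-p40`, literature-prover-lit-balaban-p40-g78-0); free-target protocol G.5-34(d), TAKING line HOME/STATUS.md
2026-08-23T19:46:47Z, window closed 20:07Z without objection (cc r15 = fold owner of rows B3.Txt@433 / B3.Prop1 / B3.Eq1.16 / B3.Eq2.5, p35,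
r14); lead g14 HEAD WORD Q35 (HOME/STATUS 2026-08-23T20:13:49Z: criterion (δ1)–(δ3) for the route) and r15 g17's request (seat INBOX 20:16:12Z:
«include the recombined one-theorem statement … say which hypotheses of `B3Prop1`'s typed statement its constants meet») are answered in §2/§3
and in «Honest scope» below; design note `lit-balaban-p40/DESIGN-B3-116-box.md` §5 (Route δ, STEP 1 / STEP 2), §7.3 item 3, §8.4, §9
(HOME/GAPS.md «G-B3-16 ADDENDUM 1», owner notes l.2887–2891: the cell's RECORDED PROOF-ROUTE DEVIATION for class (c); print's one-piece
expansion on `□` is the located open gap G-B3-16.A1).  LOCATED MEMBER of the route — no head claim (decl of record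
`B3Sect2StatementsPart2.ScaledKernels.Ineq25At`, r15; head words are the lead's).  USED BY NAME, never restated: p40's
`B3Ineq25Op116CollarRegionHolder.{ineq25At_one_zero_collar_holder_of_dict, sum_two_anchor_eq_maj}` (the (B)-level collar member at
`0 ≤ α < 1` with its explicit constant), `B3Op116CollarConst.collarK` (that constant, named), p40's `B3Op116ClassCCutoffs.{collar_step_le, core_step_le, collar_abs_le,
core_abs_le, collar_support, core_support, sub_collar_eq_core_add, exists_cutoffs}` (the configuration half), p40 g75's `B3Ineq25Op116RegularRegion.ineq25At_op116_region`
(R5, the region member at all orders `n, n′ ≥ 1`, `n + n′ > d`), the typer's `B3Eq116TwoSidedExpansion.{op116, opV, eq344_model,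
propagatorK_add_apply}` ((I.3.44)–(I.3.45) for the lattice operators), r02/p35's `B2Eq273NeumannLocality.propagatorK_congr_of_supported` (locality
of `G_k(Ω,·)` in the field), p35's `B3Op116BoxRows.{colB_dcolB_le, hcolB_le}`, p40's `B3Op116CollarDict.mixedB_le`,
`B3Op116CollarBoxFaces.{faces, exists_face_of_mem_exB, exists_face_of_mem_enB}`, `B3Op116CollarConfig.{farI_of_supp, farC_of_supp, nearP_of_supp}`,
`B3Op116RegionSources.DeepBlk`, p33's `B3Ineq25SmoothLocalization.ineq25_smooth_regularNested`, r14's `B3Ineq210RegularRegion.{Interior,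
blockUnion_of_isBigBlockUnion}`, `B1Ineq225RegularBox.{cellBox, isBigBlockUnion_cellBox}`.

## What is printed

[B3] p. 433 [PDF 23] (class (c)), verbatim: *"there exists a constant field B̃₀ such that |B̃ − B̃₀| ≤ O(r(L^kε)p(L^kε)) ≤ O(p(L^kε)²) on
the cube □. We have B̃ = B̃₀ + B̃′, and we expand in B̃′ the expressions connected with each renormalized class of graphs using the formulas
(I.3.14), (I.3.44), and (I.3.45)"* … *"we include the operators (1.16) … into the external fields"* … *"If a class contains an old vertex coming
from the expression before the expansion, then all vertices of this class are localized in □₁"*; the cubes (p. 433 l.5–7): *"We take a cube □₁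
of size r(L^kε) containing the above cube in the center, and next we take a cube □ of size 3r(L^kε) and with □₁ in the center. We assume that
□₁, □ are sums of big blocks of the unit lattice."*;  p. 412 [PDF 2]: *"dist(supp A, ∂Ω) > 2r(L^kε)"*;  (2.5) p. 424 [PDF 14]; Prop. 1
pp. 420–421 [PDF 10–11]: *"The constant δ₀ depends on the dimension d only … The constant O(1) depends on α₀, n̄ … and is independent of ε, k,
the domains Ω, Ω₁, Ω₂, the vector field B̃"*.  NOT PRINTED (the cell's Route δ): the cutoffs `χ, ψ`, the three-piece split, the
support/distance conditions below.

## What this file proves, and how (the cell's Route δ, NOT print's one-piece expansion)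

Data: the box `□ = cellBox k K₀ S`, the localization region `Ω₂ ⊆ □` (a big-block union), print's background `B̃` ((I.2.23)-regular with
`δ_B`), the constant field `B̃₀` (shift-invariant), `|B̃ − B̃₀| ≤ s` on the support of `ψ`, and two LATTICE CUTOFFS `χ, ψ : sites → [0,1]` with
steps `≤ l` per bond, `ψ = 1` on the sites of `□` and their forward neighbours, `supp χ ∩ supp ψ` (with forward neighbours) DEEP in `□`
(`DeepBlk`), and `{χ ≠ 1} ∩ supp ψ` at lattice distance `≥ R` from the interior points of `Ω₂`.  The split (`B̃′ := B̃ − B̃₀`):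
`P := B̃′·(1−χ)ψ` (COLLAR part), `A := B̃′·χψ` (CORE part) — bookkeeping (`δ_P, δ_A ≤ δ_B + 2sl`, `|P|, |A| ≤ s`, supports, `B̃ − P = A + B̃₀`
on `□`'s bonds) and the EXISTENCE of such cutoffs from two distance conditions are the companion file `B3Op116ClassCCutoffs`.
§1 THE (C)-LEVEL COLLAR MEMBERS WITH THE CONSTANT GIVEN BEFORE THE CONFIGURATION: `ineq25At_one_zero_collarBox_holder_explicit` and
`ineq25At_one_zero_collarBox_classC_explicit` — the statements of `B3Ineq25Op116CollarRegionHolder.{ineq25At_one_zero_collarBox_holder,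
ineq25At_one_zero_collarBox_classC}` with their trailing `∃ K ≥ 0` (quantified AFTER the configuration, hence certifying no uniformity as a
statement) REPLACED by the explicit `collarK(k, δ, α, s, δ_P, ε^dC₁, …, ε^dC₄, |Fc|, …)` of `B3Op116CollarConst`, given together with
`t, δ, δ₀, C_G` and the dictionary constants `C₁, C₂, C₄` before the volume and the configuration (same proofs; the (B)-level member's displayed
constant IS `collarK` at these arguments, by `rfl`).
§2 **`ineq25At_classC_split`** — THE UNDIVIDED OUTPUT AS ONE THEOREM: for fixed orders `n, n′ ≥ 1`, `n + n′ > d`: ∃ `E₀ > 0` ∀ charge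
(`e² ≤ E₀`) ∃ `K₀,min` ∀ `0 ≤ α < 1` ∀ `K₀ ≥ K₀,min` ∃ constants (collar: `t, δ, δ₀, C_G, C₁, C₂, C₄`; core: `δ₁, δ₀′, C, C_M, C_H, C_G′`), for
every volume, scale `1 ≤ k ≤ K`, `S`, `Ω₂`, and all data as above in the regime `L^k(2δ_B + 2sl)|e| ≤ t`, `L^k(2δ_B + 2sl) ≤ c|e|`,
`(L^kε)|e|s ≤ 1`, `ρL^k + L^k ≤ R`, `dL^k < R`, `ρ ≥ 1`:  (o) RECOMBINATION — `B̃ − P = A + B̃₀` on the bonds from `□`,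
`G_k(□, B̃ − P)u = G_k(□, A + B̃₀)u` for sources `u` supported in `□` (locality, `B2Eq273NeumannLocality`), and
`G_k(□,B̃)u = Σ_{j<n+n′} G_k(□,B̃₀)[V_k(A,B̃₀)G_k(□,B̃₀)]^j u + (1.16)^□_{n,n′}(A,B̃₀)u + (1.16)^□_{1,0}(P,B̃−P)u` ((I.3.44) in `P`, then
(I.3.44)–(I.3.45) in `A`: Born terms around print's `G_k(□,B̃₀)` plus the two remainders);  (a) COLLAR —
`(sect2Smooth116 … P (B̃−P) … (L^kε) 1).Ineq25At 1 0 α (min δ₀ (δ/4)) (C_G + (ε^d)^{−1}·farF(δ,ρ)·collarK(…, s, δ_B + 2sl, …, |faces k K₀ S|, …))`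
and the order `(0,1)` (§1);  (b) CORE — `(sect2Smooth116 … A B̃₀ … e_R p_R).Ineq25At n n′ α (min δ₀′ (δ₁/(4L)^{n+n′+1}))
(C_G′ + K(c₁,c₂+2c₁,d,m)(valC+derC) + holC + d·m·mixC at δ_A := δ_B + 2sl)` (R5 on `Ω = □` for `(A, B̃₀)`: `B̃₀` regular at `δ = 0`, `A + B̃₀`
regular on `□`, `A` deep-supported).
§3 **`ineq25At_classC_split_of_dist`**: §2 with the cutoffs supplied by `B3Op116ClassCCutoffs.exists_cutoffs` — (o), (a), (b) from print's data
(`B̃`, `B̃₀`, `|B̃ − B̃₀| ≤ s` within distance `R₂ + ℓ` of `Ω₂`, `Ω₂` nonempty) and two distance conditions alone: every site within distance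
`R + ℓ + 1` of `Ω₂` is deep in `□`, every site of `□` is within distance `R₂ − 1` of `Ω₂` (print's concentric cubes `□₁ ⊂ □`).

## Honest scope

ROUTE.  Lead g14's scope words (Q35), verbatim: «PROOF-ROUTE DEVIATION from p. 433 l.12–15 (disclosed, GAPS G-B3-16.A1): the collar part of
B̃′ is NOT expanded — split B̃ = P + (B̃−P), collar by support ∕ Hölder estimates (Route δ); print's one-piece expansion in B̃′ = Route γ′ (lands
as an additional member, no further head effect)».  Print expands `G_k(□, B̃₀ + B̃′)` in ALL of `B̃′`; here `B̃′` is cut into a deep core part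
`A`, expanded by (I.3.44)–(I.3.45) around `B̃₀` with remainders `(1.16)^□_{n,n′}(A,B̃₀)` bounded by R5, and a collar part `P`, whose one-`V_k`
resolvent remainder `(1.16)^□_{1,0}(P, B̃−P)` joins the external fields like `δG_k` via the collar member; print's one-piece expansion on `□`
stays the located open gap G-B3-16.A1.
HYPOTHESES.  The cutoffs `χ, ψ` and the geometry (`DeepBlk`, distance `≥ R` from `Interior_k(Ω₂)`, `ψ = 1` on `□`) are hypotheses on the
caller's configuration in §2 and are DISCHARGED in §3 from two distance conditions (print: `□₁ ⊂ □` concentric cubes of sides `r(L^kε)`,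
`3r(L^kε)`); the regime inequalities are hypotheses on `(δ_B, s, l)` exactly as the (C)-level members take them (print's `|∂B̃| ≤ O(p)`,
`|B̃′| ≤ O(rp)` on `□`, `l ≍ (rL^k)^{−1}`); `|B̃′| ≤ s` is asked on `supp ψ` (§3: within distance `R₂ + ℓ` of `Ω₂`, slightly beyond `□`) —
reducible to print's control on `□` by the `δ_B`-regularity of `B̃` (`s ≤ sup_□|B̃′| + d(ℓ+2)δ_B`-type bookkeeping, the caller's); `B̃` is taken
(I.2.23)-regular torus-wide (print's background is a global configuration).  LOCALIZATIONS: the `Ineq25At` members quantify over the carrier's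
smooth localization class at the `Interior_k(Ω₂)` cubes (print: the old vertices are localized in `□₁`), not over all `x, x′ ∈ □` up to `∂□`.
CONSTANTS versus `B3Prop1.Prop1` (r15's typed Proposition 1: `∃ δ₀ > 0` [d only] `∀ α₀ ∈ (0,1) ∀ n̄ ∃ O(1) ∀ datum ∀ class, (1.33)`), asked by
the lead's (δ3): what §2/§3 deliver is `∀ (n,n′) ∃ E₀ ∀ e² ≤ E₀ ∃ K₀,min ∀ α ∀ K₀ ≥ K₀,min ∃ (rates, constants) ∀ (ε, volume, k, □, Ω₂, B̃, cutoffs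
in the regime)`, the collar bound `C_G + (ε^d)^{−1}·farF(δ,ρ)·collarK(k, ε, s, δ_B + 2sl, |faces|, …)` and the core bound through
`valC/derC/holC/mixC(k, s, δ_A, …)` being EXPLICIT FUNCTIONS of the configuration's scalar parameters — uniform in the volume, the regions and the
fields given those parameters, but (i) the rates are produced AFTER `(E₀, α, K₀)` whereas print's `δ₀ = δ₀(d)` precedes `α₀` (a quantifier
order shared with every (C)-level member of the (2.5) lineage: R5 p362505, the torus member p358683, p33's `δG_k` member), and (ii) the constants
depend on `k` and `ε` AS WRITTEN (through `collarC`, `a_k`, `L^kε`, `(ε^d)^{−1}farF`); the companion file `B3Op116CollarCurrency`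
(`collarK_currency`, `collar_bound_currency`; not imported here) bounds `(ε^d)^{−1}·collarK` by an explicit polynomial
`collarKU(d, L, N, δ, a, C₁, C₂, C₄, |e|s, L^k|e|δ_A, n_F, m, c₁, c₂)` with NO `ε` and NO `k`, so the collar constant is uniform in `ε, k` GIVEN the
smallness parameters `|e|s`, `L^k|e|δ_A`, `n_F`, `ρ`; expressing those through print's `e(L^kε)`, `p(L^kε)`, `r(L^kε)` (p. 433 l.13–14:
`|B̃′| ≤ O(r(L^kε)p(L^kε))` on `□`; `e^{−δρ/4}` = print's `e^{−2δ′r}`) is the consumer's regime bookkeeping (DESIGN-B3-116-box.md §8.4, §9.4) and is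
NOT claimed here.  Hence, for (δ3): the constants of this glue meet the typed consumer's HYPOTHESES only after that bookkeeping and modulo (i);
as landed they are explicit and configuration-uniform.  Orders of the collar member `n + n′ = 1` only (print puts the collar-type
terms among the external fields at one `V_k`; higher orders = DESIGN §8.5, only if a consumer needs them).
Theorems only: no `def`, no new named fact, no `sorry`; axioms standard.  Value = located glue of a by-reference step of B3 — NOT summit progress
and nothing about the Yang–Mills mass gap.
-/

noncomputable section

open scoped BigOperators

namespace Literature.MathematicalPhysics.QuantumFieldTheory.Balaban1983to89.B3Ineq25Op116ClassCSplit

open HiggsLattice (ChargeData ScalarField covDeriv)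
open HiggsCovariance (propagatorK E)
open HiggsCovariancePos (Inside)
open HiggsAveraging (blockIter)
open B1Eq230FluctCov (Ix cb)
open B1TorusCubeCover (half)
open B1TorusRegionHSizes (IsBigBlockUnion)
open B1Ineq225RegularBox (cellBox isBigBlockUnion_cellBox)
open B3Ineq210RegularRegion (Interior blockUnion_of_isBigBlockUnion)
open B3Op116RegionSources (DeepBlk)
open B3Op116CollarRows (farF)
open B3Ineq31SmoothLocalization (smoothConst)
open B3Ineq25Op116Smooth (sect2Smooth116)
open B3Op116DKernelRegularTorus (valC derC)
open B3Op116HolderKernelRegularTorus (holC)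
open B3Op116MixedKernelRegularTorus (mixC)
open B3Op116CollarConst (collarK)
open B3Op116CollarBoxFaces (faces)
open B3Ineq25Op116RegularRegion (ineq25At_op116_region)
open B2Eq273NeumannLocality (propagatorK_congr_of_supported)
open B3Op116ClassCCutoffs (collar_step_le core_step_le collar_abs_le core_abs_le collar_support core_support
  sub_collar_eq_core_add exists_cutoffs)
open B3Eq116TwoSidedExpansion (op116 opV eq344_model op116_succ_left op116_zero_zero propagatorK_add_apply)

variable {P : HiggsLattice.Params} {N : ℕ}

/-! ## §1 The (C)-level collar members with the constant given BEFORE the configuration (`collarK`) -/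

section Explicit

open scoped Classical

open B3Ineq25SmoothLocalization (sect2DeltaSmooth ineq25_smooth_regularNested)
open B3Op116BoxRows (colB_dcolB_le hcolB_le)
open B3Op116CollarDict (mixedB_le)
open B3Op116MajorantStep (maj maj_rate_mono)
open B1TorusChainTransport (hol)
open B3Ineq211RegularTorus (IsAdm)
open B3Ineq210MixedRegularTorus (onb dip)
open B3Op116CollarRows (Far)
open B3Op116CollarSources (exB enB)
open B3Op116LeibnizRows (pred)
open B3Op116CollarBoxFaces (exists_face_of_mem_exB exists_face_of_mem_enB)
open B3Op116CollarConfig (farI_of_supp farC_of_supp nearP_of_supp)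
open B3Ineq25Op116CollarRegionHolder (sum_two_anchor_eq_maj ineq25At_one_zero_collar_holder_of_dict)

set_option maxHeartbeats 1600000 in
/-- **INEQUALITY (2.5) AT `(n,n′) = (1,0)`, HÖLDER EXPONENT `0 ≤ α < 1`, FOR THE ONE-`V_k` COLLAR OPERATOR ON A CELL-PRODUCT BOX
`Ω = cellBox k K₀ S`, FROM THE TREE'S DICTIONARY** — §2's member with its six (2.10) families discharged by p35's `colB_dcolB_le` and p40's
`mixedB_le`, its two (2.11) two-anchor families by p35's `hcolB_le` (for `Y` and for `P + Y`), and the `δG_k` clause by p33's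
`ineq25_smooth_regularNested` at `α`, at a common cube size and rate — THE EXPLICIT-CONSTANT FORM of
`B3Ineq25Op116CollarRegionHolder.ineq25At_one_zero_collarBox_holder` (there: `∃ K ≥ 0` AFTER the configuration; here: the constant
`collarK` of `B3Op116CollarConst` at the dictionary constants `ε^dC₁` (value/derivative), `ε^dC₂` (mixed), `ε^dC₄` (Hölder), GIVEN WITH
`t, δ, δ₀, C_G` BEFORE the configuration as a function of its scalar parameters `k, ε, s, δ_P, |Fc|`): ∃ `E₀ > 0` ∀ charge with `e² ≤ E₀`
∃ `K₀,min` ∀ `0 ≤ α < 1` ∀ `K₀ ≥ K₀,min` ∃ `t, δ, δ₀, C_G, C₁, C₂, C₄` such that for every volume, every `1 ≤ k ≤ K`, every `S`, every big-block union `Ω₂ ⊆ Ω`, all `Y, P` (regularity of `Y`,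
`P + Y`, `P`, smallness, `sup|P| ≤ s`, `ρ ≥ 1`), every face family covering the endpoints in `Ω` of the crossing bonds of `supp P`, and the
far/near GEOMETRY of `supp P` relative to the interior points of `Ω₂`:
`(sect2Smooth116 … P Y … (L^kε) 1).Ineq25At 1 0 α (min δ₀ (δ/4)) (C_G + (ε^d)^{-1}·farF(δ,ρ)·collarK(k, …, s, δ_P, ε^dC₁, …, |Fc|, …))` (and the
order (0,1)).
[cite: Balaban1983Higgs3, (2.5) p.424, (1.16) p.414, (2.10) p.426, (2.11) p.426, p.433] [cite: Balaban1982Higgs1, Prop. 2.1 p.610, (3.16) p.615] [cite: Balaban1983RegularityDecay, Theorem p.573] -/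
theorem ineq25At_one_zero_collarBox_holder_explicit (d L : ℕ) (hd : 1 ≤ d) (hL : 2 ≤ L) {a : ℝ} (ha : 0 < a) {msq : ℝ} (hmsq : 0 < msq)
    {c : ℝ} (hc : 0 ≤ c) (N m : ℕ) {c₁ c₂ : ℝ} (hc₁ : 0 ≤ c₁) (hc₂ : 0 ≤ c₂) :
    ∃ E₀ : ℝ, 0 < E₀ ∧ ∀ (C : ChargeData N), C.e ^ 2 ≤ E₀ →
      ∃ K₀min : ℕ, ∀ {α : ℝ}, 0 ≤ α → α < 1 → ∀ K₀ : ℕ, K₀min ≤ K₀ → ∃ t δ δ₀ CG C₁ C₂ C₄ : ℝ,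
        0 < t ∧ 0 < δ ∧ δ ≤ 1 ∧ 0 < δ₀ ∧ 0 ≤ CG ∧ 0 ≤ C₁ ∧ 0 ≤ C₂ ∧ 0 ≤ C₄ ∧
      ∀ (P : HiggsLattice.Params) (hP1 : 1 < P.L), P.d = d → P.L = L → K₀ ∣ P.M →
      ∀ {k : ℕ}, 1 ≤ k → k ≤ P.K → (∀ μ, 3 * half P k K₀ ≤ P.sitesPerDir 0 μ) → P.mesh k ≤ 1 →
      ∀ (S : Fin P.d → Finset ℕ) (Ω₂ : Finset (HiggsLattice.Site P 0)), IsBigBlockUnion k K₀ Ω₂ → Ω₂ ⊆ cellBox k K₀ S →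
      ∀ (Pf Y : HiggsLattice.VecField P 0) {δY δPY δP s ρ : ℝ}, 0 ≤ δY → 0 ≤ δPY → 0 ≤ δP → 0 ≤ s → 1 ≤ ρ →
        (∀ z ∈ cellBox k K₀ S, ∀ μ ν : Fin P.d, |Y ⟨z.shift ν, μ⟩ - Y ⟨z, μ⟩| ≤ δY) →
        (∀ z ∈ cellBox k K₀ S, ∀ μ ν : Fin P.d, |(Pf + Y) ⟨z.shift ν, μ⟩ - (Pf + Y) ⟨z, μ⟩| ≤ δPY) →
        (∀ (z : HiggsLattice.Site P 0) (μ ν : Fin P.d), |Pf ⟨z.shift ν, μ⟩ - Pf ⟨z, μ⟩| ≤ δP) →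
        (P.L : ℝ) ^ k * δY * |C.e| ≤ t → (P.L : ℝ) ^ k * δPY * |C.e| ≤ t → (P.L : ℝ) ^ k * δY ≤ c * |C.e| →
        (∀ b : HiggsLattice.PBond P 0, |Pf b| ≤ s) →
      ∀ (Fc : Finset (Σ ν : Fin P.d, ZMod (P.sitesPerDir 0 ν))),
        (∀ b ∈ exB (cellBox k K₀ S) Pf, ∃ f ∈ Fc, b.src f.1 = f.2) → (∀ b ∈ enB (cellBox k K₀ S) Pf, ∃ f ∈ Fc, b.tgt f.1 = f.2) →
        (∀ x x' : HiggsLattice.Site P 0, Interior k K₀ Ω₂ x → Interior k K₀ Ω₂ x' →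
          ∀ b : HiggsLattice.PBond P 0, Pf b ≠ 0 → ∀ z : HiggsLattice.Site P 0, blockIter k z = blockIter k b.src →
            Far P k ρ x z ∧ Far P k ρ z x') →
        (∀ x x' : HiggsLattice.Site P 0, Interior k K₀ Ω₂ x → Interior k K₀ Ω₂ x' →
          ∀ b : HiggsLattice.PBond P 0, (Pf b ≠ 0 ∨ Pf (pred b) ≠ 0) →
            (Far P k ρ x b.src ∧ Far P k ρ b.src x') ∧ (Far P k ρ x b.tgt ∧ Far P k ρ b.tgt x')) →
        (∀ x : HiggsLattice.Site P 0, Interior k K₀ Ω₂ x →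
          ∀ z : HiggsLattice.Site P 0, (HiggsLattice.Site.tdist x z : ℝ) ≤ (P.d : ℝ) * (P.L : ℝ) ^ k → ∀ ν : Fin P.d, Pf ⟨z, ν⟩ = 0) →
      ∀ r₀ : ℕ, Ix N →
          (sect2Smooth116 hP1 C (cellBox k K₀ S) Ω₂ Pf Y msq a k K₀ r₀ m c₁ c₂ (P.mesh k) 1).Ineq25At 1 0 α (min δ₀ (δ / 4))
            (CG + (P.mesh 0 ^ P.d)⁻¹ * farF P δ ρ *
              collarK P N C k a δ α s δP (P.mesh 0 ^ P.d * C₁) (P.mesh 0 ^ P.d * C₁) (P.mesh 0 ^ P.d * C₂) (P.mesh 0 ^ P.d * C₁)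
                (P.mesh 0 ^ P.d * C₁) (P.mesh 0 ^ P.d * C₂) (P.mesh 0 ^ P.d * C₄) (P.mesh 0 ^ P.d * C₄) Fc.card m c₁ c₂) ∧
          (sect2Smooth116 hP1 C (cellBox k K₀ S) Ω₂ Pf Y msq a k K₀ r₀ m c₁ c₂ (P.mesh k) 1).Ineq25At 0 1 α (min δ₀ (δ / 4))
            (CG + (P.mesh 0 ^ P.d)⁻¹ * farF P δ ρ *
              collarK P N C k a δ α s δP (P.mesh 0 ^ P.d * C₁) (P.mesh 0 ^ P.d * C₁) (P.mesh 0 ^ P.d * C₂) (P.mesh 0 ^ P.d * C₁)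
                (P.mesh 0 ^ P.d * C₁) (P.mesh 0 ^ P.d * C₂) (P.mesh 0 ^ P.d * C₄) (P.mesh 0 ^ P.d * C₄) Fc.card m c₁ c₂) := by
  obtain ⟨E₀, hE₀, hG⟩ := ineq25_smooth_regularNested d L hd hL ha hmsq hc N m hc₁ hc₂
  refine ⟨E₀, hE₀, fun C heC => ?_⟩
  obtain ⟨K₃, hK₃⟩ := hG C heC
  obtain ⟨K₁, hK₁⟩ := colB_dcolB_le d L hd hL ha hmsq N C
  obtain ⟨K₂, hK₂⟩ := mixedB_le d L hd hL ha hmsq N C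
  obtain ⟨K₄, hK₄⟩ := hcolB_le d L hd hL ha hmsq N C
  refine ⟨max (max (max K₁ K₂) (max K₃ K₄)) 1, fun {α} hα0 hα1 K₀ hK₀ => ?_⟩
  have hK₀1 : 1 ≤ K₀ := (le_max_right _ _).trans hK₀
  obtain ⟨t₁, δ₁, C₁, ht₁, hδ₁, hC₁, h1⟩ :=
    hK₁ K₀ ((le_max_left K₁ K₂).trans ((le_max_left _ _).trans ((le_max_left _ _).trans hK₀)))
  obtain ⟨t₂, δ₂, C₂, ht₂, hδ₂, hC₂, h2⟩ :=
    hK₂ K₀ ((le_max_right K₁ K₂).trans ((le_max_left _ _).trans ((le_max_left _ _).trans hK₀)))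
  obtain ⟨t₃, δ₃, C₃, ht₃, hδ₃, hC₃, h3⟩ :=
    hK₃ hα0 hα1 K₀ ((le_max_left K₃ K₄).trans ((le_max_right _ _).trans ((le_max_left _ _).trans hK₀)))
  obtain ⟨t₄, δ₄, C₄, ht₄, hδ₄, hC₄, h4⟩ :=
    hK₄ hα0 hα1 K₀ ((le_max_right K₃ K₄).trans ((le_max_right _ _).trans ((le_max_left _ _).trans hK₀)))
  -- the common smallness threshold and the common rate
  set t : ℝ := min (min t₁ t₂) (min t₃ t₄) with htdef
  set δ : ℝ := min (min δ₁ δ₂) (min δ₄ 1) with hδdef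
  have htt₁ : t ≤ t₁ := (min_le_left _ _).trans (min_le_left _ _)
  have htt₂ : t ≤ t₂ := (min_le_left _ _).trans (min_le_right _ _)
  have htt₃ : t ≤ t₃ := (min_le_right _ _).trans (min_le_left _ _)
  have htt₄ : t ≤ t₄ := (min_le_right _ _).trans (min_le_right _ _)
  have hδδ₁ : δ ≤ δ₁ := (min_le_left _ _).trans (min_le_left _ _)
  have hδδ₂ : δ ≤ δ₂ := (min_le_left _ _).trans (min_le_right _ _)
  have hδδ₄ : δ ≤ δ₄ := (min_le_right _ _).trans (min_le_left _ _)
  have hδ1 : δ ≤ 1 := (min_le_right _ _).trans (min_le_right _ _)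
  have hδ0 : 0 < δ := lt_min (lt_min hδ₁ hδ₂) (lt_min hδ₄ one_pos)
  refine ⟨t, δ, δ₃, C₃, C₁, C₂, C₄, lt_min (lt_min ht₁ ht₂) (lt_min ht₃ ht₄), hδ0, hδ1, hδ₃, hC₃.le, hC₁.le, hC₂.le, hC₄.le, ?_⟩
  intro P hP1 hPd hPL hK₀M k hk hkK h3h hmesh S Ω₂ hΩ₂ hsub Pf Y δY δPY δP s ρ hδY hδPY hδP hs hρ hregY hregPY hregP htY htPY hcY hP
    Fc hexF henF hfarI hfarC hnearP r₀ i₀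
  have hL2 : 2 ≤ P.L := by rw [hPL]; exact hL
  have hε := P.mesh_pos 0
  have hεd : 0 ≤ P.mesh 0 ^ P.d := pow_nonneg hε.le _
  have hcC₁ : 0 ≤ P.mesh 0 ^ P.d * C₁ := mul_nonneg hεd hC₁.le
  have hcC₂ : 0 ≤ P.mesh 0 ^ P.d * C₂ := mul_nonneg hεd hC₂.le
  have hcC₄ : 0 ≤ P.mesh 0 ^ P.d * C₄ := mul_nonneg hεd hC₄.le
  have hak : 0 ≤ B1.aSeq a P.L k := (B1.aSeq_pos ha (by exact_mod_cast hP1) hk).le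
  have hΩ : ∀ x x' : HiggsLattice.Site P 0, blockIter k x = blockIter k x' → (x ∈ cellBox k K₀ S ↔ x' ∈ cellBox k K₀ S) :=
    blockUnion_of_isBigBlockUnion le_rfl (isBigBlockUnion_cellBox S)
  -- the (2.10) dictionary of `G_k(Ω,X)` for `X = Y` and `X = P + Y`, at the common rate
  have hdict : ∀ (X : HiggsLattice.VecField P 0) {δX : ℝ}, 0 ≤ δX →
      (∀ z ∈ cellBox k K₀ S, ∀ μ ν : Fin P.d, |X ⟨z.shift ν, μ⟩ - X ⟨z, μ⟩| ≤ δX) → (P.L : ℝ) ^ k * δX * |C.e| ≤ t →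
      (∀ u y : HiggsLattice.Site P 0, u ∈ cellBox k K₀ S → y ∈ cellBox k K₀ S →
        ∑ i : Ix N, ‖propagatorK C (cellBox k K₀ S) X msq a k (cb P N 0 (y, i)) u‖ ≤ maj P k (P.mesh 0 ^ P.d * C₁) 2 δ u y) ∧
      (∀ y ∈ cellBox k K₀ S, ∀ b : HiggsLattice.PBond P 0, Inside (cellBox k K₀ S) b →
        ∑ i : Ix N, ‖covDeriv C X (propagatorK C (cellBox k K₀ S) X msq a k (cb P N 0 (y, i))) b‖
          ≤ maj P k (P.mesh 0 ^ P.d * C₁) 1 δ b.src y) ∧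
      (∀ b b' : HiggsLattice.PBond P 0, Inside (cellBox k K₀ S) b → Inside (cellBox k K₀ S) b' →
        (P.mesh 0)⁻¹ * ∑ i : Ix N, ‖covDeriv C X (propagatorK C (cellBox k K₀ S) X msq a k (dip C X b' (onb N i))) b‖
          ≤ maj P k (P.mesh 0 ^ P.d * C₂) 0 δ b.src b'.src) ∧
      (∀ (μ : Fin P.d) (x₁ x₂ y : HiggsLattice.Site P 0), x₂ ≠ x₁ → x₁ ∈ cellBox k K₀ S → x₁.shift μ ∈ cellBox k K₀ S →
        x₂ ∈ cellBox k K₀ S → x₂.shift μ ∈ cellBox k K₀ S → y ∈ cellBox k K₀ S →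
        ∀ Γ : List (HiggsLattice.Site P 0), IsAdm x₁ x₂ Γ → (∀ z ∈ Γ, z ∈ cellBox k K₀ S) →
        (∑ i : Ix N, ‖hol C X x₁ Γ (covDeriv C X (propagatorK C (cellBox k K₀ S) X msq a k (cb P N 0 (y, i))) ⟨x₂, μ⟩)
            - covDeriv C X (propagatorK C (cellBox k K₀ S) X msq a k (cb P N 0 (y, i))) ⟨x₁, μ⟩‖)
            / (P.mesh 0 * (HiggsLattice.Site.tdist x₁ x₂ : ℝ)) ^ α
          ≤ maj P k (P.mesh 0 ^ P.d * C₄) (1 - α) δ x₁ y + maj P k (P.mesh 0 ^ P.d * C₄) (1 - α) δ x₂ y) := by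
    intro X δX hδX hregX htX
    have hh := fun x y hx hy => h1 P hP1 hPd hPL hK₀M hk hkK h3h hmesh S X hδX hregX (htX.trans htt₁) x y hx hy
    refine ⟨fun u y hu hy => ?_, fun y hy b hb => ?_, fun b b' hb hb' => ?_, fun μ x₁ x₂ y hne hx₁ hx₁μ hx₂ hx₂μ hy Γ hΓ hΓΩ => ?_⟩
    · exact ((hh u y hu hy).1).trans (maj_rate_mono hcC₁ hδδ₁ u y)
    · exact ((hh b.src y hb.1 hy).2 b.dir hb.2).trans (maj_rate_mono hcC₁ hδδ₁ b.src y)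
    · exact (h2 P hP1 hPd hPL hK₀M hk hkK h3h hmesh S X hδX hregX (htX.trans htt₂) b.dir b'.dir b.src b'.src hb.1 hb.2 hb'.1
        hb'.2).trans (maj_rate_mono hcC₂ hδδ₂ b.src b'.src)
    · have h := h4 P hP1 hPd hPL hK₀M hk hkK h3h hmesh S X hδX hregX (htX.trans htt₄) μ x₁ x₂ y hne hx₁ hx₁μ hx₂ hx₂μ hy Γ hΓ hΓΩ
      rw [sum_two_anchor_eq_maj] at h
      exact h.trans (add_le_add (maj_rate_mono hcC₄ hδδ₄ x₁ y) (maj_rate_mono hcC₄ hδδ₄ x₂ y))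
  obtain ⟨hcolY, hdcolY, hmixY, hhcolY⟩ := hdict Y hδY hregY htY
  obtain ⟨hcolPY, hdcolPY, hmixPY, hhcolPY⟩ := hdict (Pf + Y) hδPY hregPY htPY
  -- the `δG_k(Ω,Ω₂,Y)` clause with smooth localizations at `α`
  have hδG : (sect2DeltaSmooth hP1 C (cellBox k K₀ S) Ω₂ Y msq a k K₀ r₀ m c₁ c₂).Ineq25 α δ₃ C₃ :=
    h3 P hP1 hPd hPL hK₀M hk hkK h3h hmesh (cellBox k K₀ S) Ω₂ (isBigBlockUnion_cellBox S) hΩ₂ hsub Y hδY hregY (htY.trans htt₃) hcY r₀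
  have hI : ∀ x : HiggsLattice.Site P 0, Interior k K₀ Ω₂ x → x ∈ cellBox k K₀ S ∧ ∀ μ : Fin P.d, x.shift μ ∈ cellBox k K₀ S :=
    fun x hx => ⟨hsub hx.mem, fun μ => hsub (hx.shift_mem μ)⟩
  have hmem := ineq25At_one_zero_collar_holder_of_dict (K₀ := K₀) (r₀ := r₀) (m := m) (hL1 := hP1) (c₁ := c₁) (c₂ := c₂) C
    (cellBox k K₀ S) Ω₂ Pf Y a hmsq hak hΩ hL2 hk hkK hK₀1 hδ0 hδ1 hρ hs hcC₁ hcC₁ hcC₂ hcC₁ hcC₁ hcC₂ hP i₀ hc₁ hc₂ hC₃.le hα0 hα1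
    hδP hcC₄ hcC₄ hregP hδG hhcolY hhcolPY Fc hexF henF hcolY hdcolY hmixY hcolPY hdcolPY hmixPY hsub hI hfarI hfarC hnearP
  exact hmem

/-- **INEQUALITY (2.5) AT `(n,n′) = (1,0)`, `0 ≤ α < 1`, FOR THE COLLAR OPERATOR OF A CLASS-(c) CONFIGURATION ON A CELL-PRODUCT BOX,
EXPLICIT-CONSTANT FORM** of `B3Ineq25Op116CollarRegionHolder.ineq25At_one_zero_collarBox_classC` (constant `collarK(…, |faces k K₀ S|, …)` given
before the configuration) — the previous theorem with its configuration hypotheses DISCHARGED: the face family is `faces k K₀ S` (`B3Op116CollarBoxFaces`), and the far/near geometry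
comes from ONE support condition on `P` (the cell's Route δ condition on the collar part `P = B̃′(1−χ)`, G-B3-16.A1 — not a printed
sentence; p. 433 prints `B̃ = B̃₀ + B̃′` with `|B̃ − B̃₀| ≤ O(r(L^kε)p(L^kε))` on `□`), relative to the interior points of `Ω₂`:
`∀ b, P(b) ≠ 0 → ∀ x, Interior_k(Ω₂) x → R ≤ |x − b₋|` with `ρL^k + L^k ≤ R` and `dL^k < R` (`B3Op116CollarConfig`).  Remaining data: regularity of `Y`, `P + Y`, `P`, smallness, `sup|P| ≤ s`, `ρ ≥ 1`.
[cite: Balaban1983Higgs3, (2.5) p.424, (1.16) p.414, p.433 l.12–15] [cite: Balaban1982Higgs1, Prop. 2.1 p.610–611, (3.16) p.615] -/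
theorem ineq25At_one_zero_collarBox_classC_explicit (d L : ℕ) (hd : 1 ≤ d) (hL : 2 ≤ L) {a : ℝ} (ha : 0 < a) {msq : ℝ} (hmsq : 0 < msq)
    {c : ℝ} (hc : 0 ≤ c) (N m : ℕ) {c₁ c₂ : ℝ} (hc₁ : 0 ≤ c₁) (hc₂ : 0 ≤ c₂) :
    ∃ E₀ : ℝ, 0 < E₀ ∧ ∀ (C : ChargeData N), C.e ^ 2 ≤ E₀ →
      ∃ K₀min : ℕ, ∀ {α : ℝ}, 0 ≤ α → α < 1 → ∀ K₀ : ℕ, K₀min ≤ K₀ → ∃ t δ δ₀ CG C₁ C₂ C₄ : ℝ,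
        0 < t ∧ 0 < δ ∧ δ ≤ 1 ∧ 0 < δ₀ ∧ 0 ≤ CG ∧ 0 ≤ C₁ ∧ 0 ≤ C₂ ∧ 0 ≤ C₄ ∧
      ∀ (P : HiggsLattice.Params) (hP1 : 1 < P.L), P.d = d → P.L = L → K₀ ∣ P.M →
      ∀ {k : ℕ}, 1 ≤ k → k ≤ P.K → (∀ μ, 3 * half P k K₀ ≤ P.sitesPerDir 0 μ) → P.mesh k ≤ 1 →
      ∀ (S : Fin P.d → Finset ℕ) (Ω₂ : Finset (HiggsLattice.Site P 0)), IsBigBlockUnion k K₀ Ω₂ → Ω₂ ⊆ cellBox k K₀ S →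
      ∀ (Pf Y : HiggsLattice.VecField P 0) {δY δPY δP s ρ R : ℝ}, 0 ≤ δY → 0 ≤ δPY → 0 ≤ δP → 0 ≤ s → 1 ≤ ρ →
        (∀ z ∈ cellBox k K₀ S, ∀ μ ν : Fin P.d, |Y ⟨z.shift ν, μ⟩ - Y ⟨z, μ⟩| ≤ δY) →
        (∀ z ∈ cellBox k K₀ S, ∀ μ ν : Fin P.d, |(Pf + Y) ⟨z.shift ν, μ⟩ - (Pf + Y) ⟨z, μ⟩| ≤ δPY) →
        (∀ (z : HiggsLattice.Site P 0) (μ ν : Fin P.d), |Pf ⟨z.shift ν, μ⟩ - Pf ⟨z, μ⟩| ≤ δP) →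
        (P.L : ℝ) ^ k * δY * |C.e| ≤ t → (P.L : ℝ) ^ k * δPY * |C.e| ≤ t → (P.L : ℝ) ^ k * δY ≤ c * |C.e| →
        (∀ b : HiggsLattice.PBond P 0, |Pf b| ≤ s) →
        ρ * (P.L : ℝ) ^ k + (P.L : ℝ) ^ k ≤ R → (P.d : ℝ) * (P.L : ℝ) ^ k < R →
        (∀ b : HiggsLattice.PBond P 0, Pf b ≠ 0 → ∀ x : HiggsLattice.Site P 0, Interior k K₀ Ω₂ x →
          R ≤ (HiggsLattice.Site.tdist x b.src : ℝ)) →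
      ∀ r₀ : ℕ, Ix N →
          (sect2Smooth116 hP1 C (cellBox k K₀ S) Ω₂ Pf Y msq a k K₀ r₀ m c₁ c₂ (P.mesh k) 1).Ineq25At 1 0 α (min δ₀ (δ / 4))
            (CG + (P.mesh 0 ^ P.d)⁻¹ * farF P δ ρ *
              collarK P N C k a δ α s δP (P.mesh 0 ^ P.d * C₁) (P.mesh 0 ^ P.d * C₁) (P.mesh 0 ^ P.d * C₂) (P.mesh 0 ^ P.d * C₁)
                (P.mesh 0 ^ P.d * C₁) (P.mesh 0 ^ P.d * C₂) (P.mesh 0 ^ P.d * C₄) (P.mesh 0 ^ P.d * C₄) (faces k K₀ S).card m c₁ c₂) ∧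
          (sect2Smooth116 hP1 C (cellBox k K₀ S) Ω₂ Pf Y msq a k K₀ r₀ m c₁ c₂ (P.mesh k) 1).Ineq25At 0 1 α (min δ₀ (δ / 4))
            (CG + (P.mesh 0 ^ P.d)⁻¹ * farF P δ ρ *
              collarK P N C k a δ α s δP (P.mesh 0 ^ P.d * C₁) (P.mesh 0 ^ P.d * C₁) (P.mesh 0 ^ P.d * C₂) (P.mesh 0 ^ P.d * C₁)
                (P.mesh 0 ^ P.d * C₁) (P.mesh 0 ^ P.d * C₂) (P.mesh 0 ^ P.d * C₄) (P.mesh 0 ^ P.d * C₄) (faces k K₀ S).card m c₁ c₂) := by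
  obtain ⟨E₀, hE₀, hG⟩ := ineq25At_one_zero_collarBox_holder_explicit d L hd hL ha hmsq hc N m hc₁ hc₂
  refine ⟨E₀, hE₀, fun C heC => ?_⟩
  obtain ⟨K₀min, h⟩ := hG C heC
  refine ⟨K₀min, fun {α} hα0 hα1 K₀ hK₀ => ?_⟩
  obtain ⟨t, δ, δ₀, CG, C₁, C₂, C₄, ht, hδ, hδ1, hδ₀, hCG, hC₁, hC₂, hC₄, h⟩ := h hα0 hα1 K₀ hK₀
  refine ⟨t, δ, δ₀, CG, C₁, C₂, C₄, ht, hδ, hδ1, hδ₀, hCG, hC₁, hC₂, hC₄, ?_⟩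
  intro P hP1 hPd hPL hK₀M k hk hkK h3h hmesh S Ω₂ hΩ₂ hsub Pf Y δY δPY δP s ρ R hδY hδPY hδP hs hρ hregY hregPY hregP htY htPY hcY hP
    hRfar hRnear hsupp r₀ i₀
  have hL2 : 2 ≤ P.L := by rw [hPL]; exact hL
  exact h P hP1 hPd hPL hK₀M hk hkK h3h hmesh S Ω₂ hΩ₂ hsub Pf Y hδY hδPY hδP hs hρ hregY hregPY hregP htY htPY hcY hP
    (faces k K₀ S) (exists_face_of_mem_exB S Pf) (exists_face_of_mem_enB S Pf)
    (farI_of_supp hkK hRfar hsupp) (farC_of_supp hL2 hk hRfar hsupp) (nearP_of_supp hRnear hsupp) r₀ i₀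


end Explicit

/-! ## §2 Both (2.5) members for the pieces, under one charge threshold and one cube size -/

section Main

/-- **[B3] p. 433 class (c) BY THE CELL'S ROUTE δ — BOTH (2.5) MEMBERS FOR THE PIECES OF THE SPLIT `B̃ = B̃₀ + B̃′(1−ψ) + A + P`.**  For fixed
orders `n, n′ ≥ 1` with `n + n′ > d`: ∃ `E₀ > 0` ∀ charge with `e² ≤ E₀` ∃ `K₀,min` ∀ `0 ≤ α < 1` ∀ `K₀ ≥ K₀,min` ∃ `t > 0`, `0 < δ ≤ 1`,
`δ₀ > 0`, `C_G ≥ 0`, dictionary constants `C₁, C₂, C₄ ≥ 0` (collar), `0 < δ₁ ≤ 1`, `δ₀′ > 0`, `C, C_M, C_H, C_G′ ≥ 0` (core), such that on every torus (dimension `d`, ratio `L`,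
`K₀ ∣ M`), every scale `1 ≤ k ≤ K` with `≥ 3` cubes per direction and `L^kε ≤ 1`, every box `□ = cellBox k K₀ S` and big-block union `Ω₂ ⊆ □`,
all backgrounds `B̃` ((I.2.23)-regular, `δ_B`), shift-invariant `B̃₀`, cutoffs `χ, ψ : sites → [0,1]` with steps `≤ l`, `|B̃ − B̃₀| ≤ s` on
`supp ψ`, `ψ = 1` on `□` and its forward neighbours, `supp χ ∩ supp ψ` deep in `□` (with forward neighbours), `{χ ≠ 1} ∩ supp ψ` at
distance `≥ R` from `Interior_k(Ω₂)`, `ρL^k + L^k ≤ R`, `dL^k < R`, `ρ ≥ 1`, in the regime `L^k(2δ_B + 2sl)|e| ≤ t`, `L^k(2δ_B + 2sl) ≤ c|e|`,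
`(L^kε)|e|s ≤ 1`, and the pieces `P = B̃′(1−χ)ψ` (collar), `A = B̃′χψ` (core), `B̃′ = B̃ − B̃₀`:
(o) RECOMBINATION: `B̃ − P = A + B̃₀` on the bonds from `□`, hence `G_k(□, B̃ − P)u = G_k(□, A + B̃₀)u` for sources `u` supported in `□`
(locality), and PRINT'S PROPAGATOR ON `□` IS THE UNDIVIDED SUM
`G_k(□,B̃)u = Σ_{j<n+n′} G_k(□,B̃₀)[V_k(A,B̃₀)G_k(□,B̃₀)]^j u + (1.16)^□_{n,n′}(A,B̃₀)u + (1.16)^□_{1,0}(P,B̃−P)u` ((I.3.44) in `P`, then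
(I.3.44)–(I.3.45) in `A`) — Born terms around print's `G_k(□,B̃₀)` plus the two remainders bounded in (a), (b);
(a) COLLAR: `(sect2Smooth116 … P (B̃ − P) … (L^kε) 1).Ineq25At 1 0 α (min δ₀ (δ/4)) (C_G + (ε^d)^{−1}·farF(δ,ρ)·collarK(k,δ,α,s,δ_B+2sl,
ε^dC₁,…,ε^dC₄,|faces k K₀ S|,m,c₁,c₂))` and the order `(0,1)` (§1 `ineq25At_one_zero_collarBox_classC_explicit`: the constant is the explicit
`B3Op116CollarConst.collarK`, given before the configuration);  (b) CORE: for all carrier parameters `0 ≤ e_Rp_R`, `L^kε ≤ e_Rp_R`,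
`(sect2Smooth116 … A B̃₀ … e_R p_R).Ineq25At n n′ α (min δ₀′ (δ₁/(4L)^{n+n′+1})) (C_G′ + K(c₁,c₂+2c₁,d,m)(valC + derC) + holC + d·m·mixC)` at
`δ_A := δ_B + 2sl` (p40's R5 `ineq25At_op116_region` on `Ω = □` for `(A, B̃₀)`: `B̃₀` regular at `δ = 0`, `A + B̃₀` regular on `□`, `A`
deep-supported).  Route δ is a recorded proof-route deviation from p. 433 l.12–15 (G-B3-16.A1); no head claim.
[cite: Balaban1983Higgs3, p.433 l.12–15, (2.5) p.424, (1.16) p.414, p.412] [cite: Balaban1982Higgs1, Prop. 2.1 (2.20)-(2.25) p.610, (3.44) p.619] [cite: Balaban1983RegularityDecay, Theorem p.573] -/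
theorem ineq25At_classC_split (d L : ℕ) (hd : 1 ≤ d) (hL : 2 ≤ L) {a : ℝ} (ha : 0 < a) {msq : ℝ} (hmsq : 0 < msq)
    {c : ℝ} (hc : 0 ≤ c) (N m : ℕ) {c₁ c₂ : ℝ} (hc₁ : 0 ≤ c₁) (hc₂ : 0 ≤ c₂)
    (n n' : ℕ) (hn : 1 ≤ n) (hn' : 1 ≤ n') (hdn : d < n + n') :
    ∃ E₀ : ℝ, 0 < E₀ ∧ ∀ (C : ChargeData N), C.e ^ 2 ≤ E₀ →
      ∃ K₀min : ℕ, ∀ {α : ℝ}, 0 ≤ α → α < 1 → ∀ K₀ : ℕ, K₀min ≤ K₀ →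
      ∃ t δ δ₀ CG C₁ C₂ C₄ δ₁ δ₀' Cst CM CH CG' : ℝ, 0 < t ∧ 0 < δ ∧ δ ≤ 1 ∧ 0 < δ₀ ∧ 0 ≤ CG ∧ 0 ≤ C₁ ∧ 0 ≤ C₂ ∧ 0 ≤ C₄ ∧
          0 < δ₁ ∧ δ₁ ≤ 1 ∧ 0 < δ₀' ∧ 0 ≤ Cst ∧ 0 ≤ CM ∧ 0 ≤ CH ∧ 0 ≤ CG' ∧
      ∀ (P : HiggsLattice.Params) (hP1 : 1 < P.L), P.d = d → P.L = L → K₀ ∣ P.M →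
      ∀ {k : ℕ}, 1 ≤ k → k ≤ P.K → (∀ μ, 3 * half P k K₀ ≤ P.sitesPerDir 0 μ) → P.mesh k ≤ 1 →
      ∀ (S : Fin P.d → Finset ℕ) (Ω₂ : Finset (HiggsLattice.Site P 0)), IsBigBlockUnion k K₀ Ω₂ → Ω₂ ⊆ cellBox k K₀ S →
      ∀ (Bt B0 : HiggsLattice.VecField P 0) (χ ψ : HiggsLattice.Site P 0 → ℝ) {δB s l ρ R : ℝ},
        0 ≤ δB → 0 ≤ s → 0 ≤ l → 1 ≤ ρ →
        (∀ (z : HiggsLattice.Site P 0) (μ ν : Fin P.d), B0 ⟨z.shift ν, μ⟩ = B0 ⟨z, μ⟩) →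
        (∀ (z : HiggsLattice.Site P 0) (μ ν : Fin P.d), |Bt ⟨z.shift ν, μ⟩ - Bt ⟨z, μ⟩| ≤ δB) →
        (∀ (z : HiggsLattice.Site P 0) (μ : Fin P.d), ψ z ≠ 0 → |Bt ⟨z, μ⟩ - B0 ⟨z, μ⟩| ≤ s) →
        (∀ z, 0 ≤ χ z ∧ χ z ≤ 1) → (∀ z, 0 ≤ ψ z ∧ ψ z ≤ 1) →
        (∀ (z : HiggsLattice.Site P 0) (ν : Fin P.d), |χ (z.shift ν) - χ z| ≤ l) →
        (∀ (z : HiggsLattice.Site P 0) (ν : Fin P.d), |ψ (z.shift ν) - ψ z| ≤ l) →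
        (∀ z ∈ cellBox k K₀ S, ψ z = 1 ∧ ∀ ν : Fin P.d, ψ (z.shift ν) = 1) →
        (∀ z : HiggsLattice.Site P 0, χ z ≠ 0 → ψ z ≠ 0 →
          DeepBlk k K₀ (cellBox k K₀ S) z ∧ ∀ μ : Fin P.d, DeepBlk k K₀ (cellBox k K₀ S) (z.shift μ)) →
        (∀ z : HiggsLattice.Site P 0, χ z ≠ 1 → ψ z ≠ 0 →
          ∀ x : HiggsLattice.Site P 0, Interior k K₀ Ω₂ x → R ≤ (HiggsLattice.Site.tdist x z : ℝ)) →
        ρ * (P.L : ℝ) ^ k + (P.L : ℝ) ^ k ≤ R → (P.d : ℝ) * (P.L : ℝ) ^ k < R →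
        (P.L : ℝ) ^ k * (δB + (δB + s * (l + l))) * |C.e| ≤ t → (P.L : ℝ) ^ k * (δB + (δB + s * (l + l))) ≤ c * |C.e| →
        P.mesh k * (|C.e| * s) ≤ 1 →
      ∀ (Pc A : HiggsLattice.VecField P 0),
        (∀ b : HiggsLattice.PBond P 0, Pc b = (Bt b - B0 b) * ((1 - χ b.src) * ψ b.src)) →
        (∀ b : HiggsLattice.PBond P 0, A b = (Bt b - B0 b) * (χ b.src * ψ b.src)) →
      ∀ r₀ : ℕ, Ix N →
        ((∀ b : HiggsLattice.PBond P 0, b.src ∈ cellBox k K₀ S → (Bt - Pc) b = (A + B0) b) ∧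
          (∀ u : ScalarField P 0 N, (∀ x, x ∉ cellBox k K₀ S → u x = 0) →
            propagatorK C (cellBox k K₀ S) (Bt - Pc) msq a k u = propagatorK C (cellBox k K₀ S) (A + B0) msq a k u) ∧
          (∀ u : ScalarField P 0 N, (∀ x, x ∉ cellBox k K₀ S → u x = 0) →
            propagatorK C (cellBox k K₀ S) Bt msq a k u =
              (∑ j ∈ Finset.range (n + n'), (propagatorK C (cellBox k K₀ S) B0 msq a k *
                  (opV C (cellBox k K₀ S) A B0 msq a k * propagatorK C (cellBox k K₀ S) B0 msq a k) ^ j) u)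
                + op116 C (cellBox k K₀ S) A B0 msq a k n n' u + op116 C (cellBox k K₀ S) Pc (Bt - Pc) msq a k 1 0 u)) ∧
        ((sect2Smooth116 hP1 C (cellBox k K₀ S) Ω₂ Pc (Bt - Pc) msq a k K₀ r₀ m c₁ c₂ (P.mesh k) 1).Ineq25At 1 0 α (min δ₀ (δ / 4))
            (CG + (P.mesh 0 ^ P.d)⁻¹ * farF P δ ρ *
              collarK P N C k a δ α s (δB + s * (l + l)) (P.mesh 0 ^ P.d * C₁) (P.mesh 0 ^ P.d * C₁)
                (P.mesh 0 ^ P.d * C₂) (P.mesh 0 ^ P.d * C₁) (P.mesh 0 ^ P.d * C₁) (P.mesh 0 ^ P.d * C₂) (P.mesh 0 ^ P.d * C₄)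
                (P.mesh 0 ^ P.d * C₄) (faces k K₀ S).card m c₁ c₂) ∧
          (sect2Smooth116 hP1 C (cellBox k K₀ S) Ω₂ Pc (Bt - Pc) msq a k K₀ r₀ m c₁ c₂ (P.mesh k) 1).Ineq25At 0 1 α (min δ₀ (δ / 4))
            (CG + (P.mesh 0 ^ P.d)⁻¹ * farF P δ ρ *
              collarK P N C k a δ α s (δB + s * (l + l)) (P.mesh 0 ^ P.d * C₁) (P.mesh 0 ^ P.d * C₁)
                (P.mesh 0 ^ P.d * C₂) (P.mesh 0 ^ P.d * C₁) (P.mesh 0 ^ P.d * C₁) (P.mesh 0 ^ P.d * C₂) (P.mesh 0 ^ P.d * C₄)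
                (P.mesh 0 ^ P.d * C₄) (faces k K₀ S).card m c₁ c₂)) ∧
        (∀ {eR pR : ℝ}, 0 ≤ eR * pR → P.mesh k ≤ eR * pR →
          (sect2Smooth116 hP1 C (cellBox k K₀ S) Ω₂ A B0 msq a k K₀ r₀ m c₁ c₂ eR pR).Ineq25At n n' α
            (min δ₀' (δ₁ / (4 * (P.L : ℝ)) ^ (n + n' + 1)))
            (CG' + (smoothConst P.d m c₁ (c₂ + 2 * c₁) *
                (valC P N C k a δ₁ Cst s (δB + s * (l + l)) (n + n') + derC P N C k a δ₁ Cst s (δB + s * (l + l)) (n + n'))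
              + (holC P N C k a δ₁ Cst s (δB + s * (l + l)) α (P.mesh 0 ^ P.d * CH) (n + n' - 1)
                + P.d * m * mixC P N C k a δ₁ Cst CM s (δB + s * (l + l)) (n + n'))))) := by
  obtain ⟨E₁, hE₁, hG₁⟩ := ineq25At_one_zero_collarBox_classC_explicit d L hd hL ha hmsq hc N m hc₁ hc₂
  obtain ⟨E₂, hE₂, hG₂⟩ := ineq25At_op116_region d L hd hL ha hmsq hc N m hc₁ hc₂ n n' hn hn' hdn
  refine ⟨min E₁ E₂, lt_min hE₁ hE₂, fun C heC => ?_⟩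
  obtain ⟨K₁, hK₁⟩ := hG₁ C (heC.trans (min_le_left _ _))
  obtain ⟨K₂, hK₂⟩ := hG₂ C (heC.trans (min_le_right _ _))
  refine ⟨max K₁ K₂, fun {α} hα0 hα1 K₀ hK₀ => ?_⟩
  obtain ⟨t₁, δ, δ₀, CG, C₁, C₂, C₄, ht₁, hδ, hδ1, hδ₀, hCG, hC₁, hC₂, hC₄, h1⟩ := hK₁ hα0 hα1 K₀ ((le_max_left _ _).trans hK₀)
  obtain ⟨t₂, δ₁, δ₀', Cst, CM, CH, CG', ht₂, hδ₁, hδ₁1, hδ₀', hCst, hCM, hCH, hCG', h2⟩ :=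
    hK₂ hα0 hα1 K₀ ((le_max_right _ _).trans hK₀)
  refine ⟨min t₁ t₂, δ, δ₀, CG, C₁, C₂, C₄, δ₁, δ₀', Cst, CM, CH, CG', lt_min ht₁ ht₂, hδ, hδ1, hδ₀, hCG, hC₁, hC₂, hC₄, hδ₁, hδ₁1,
    hδ₀', hCst, hCM, hCH, hCG', ?_⟩
  intro P hP1 hPd hPL hK₀M k hk hkK h3h hmesh S Ω₂ hΩ₂ hsub Bt B0 χ ψ δB s l ρ R hδB hs hl hρ hB0 hregBt hsz hχ01 hψ01 hχ hψ hψbox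
    hχdeep hfar hRfar hRnear hsm hsmc hsm1 Pc A hPc hA r₀ i₀
  -- §2 bookkeeping of the pieces
  have hδP : ∀ (z : HiggsLattice.Site P 0) (μ ν : Fin P.d), |Pc ⟨z.shift ν, μ⟩ - Pc ⟨z, μ⟩| ≤ δB + s * (l + l) :=
    collar_step_le Bt B0 Pc χ ψ hPc hs hl hB0 hregBt hsz hχ01 hψ01 hχ hψ
  have hδA : ∀ (z : HiggsLattice.Site P 0) (μ ν : Fin P.d), |A ⟨z.shift ν, μ⟩ - A ⟨z, μ⟩| ≤ δB + s * (l + l) :=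
    core_step_le Bt B0 A χ ψ hA hs hl hB0 hregBt hsz hχ01 hψ01 hχ hψ
  have hPs : ∀ b : HiggsLattice.PBond P 0, |Pc b| ≤ s := collar_abs_le Bt B0 Pc χ ψ hPc hs hsz hχ01 hψ01
  have hAs : ∀ b : HiggsLattice.PBond P 0, |A b| ≤ s := core_abs_le Bt B0 A χ ψ hA hs hsz hχ01 hψ01
  have hδP0 : 0 ≤ δB + s * (l + l) := by positivity
  have hδY0 : 0 ≤ δB + (δB + s * (l + l)) := by positivity
  have hPY : Pc + (Bt - Pc) = Bt := add_sub_cancel Pc Bt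
  have hregY : ∀ (z : HiggsLattice.Site P 0) (μ ν : Fin P.d),
      |(Bt - Pc) ⟨z.shift ν, μ⟩ - (Bt - Pc) ⟨z, μ⟩| ≤ δB + (δB + s * (l + l)) := by
    intro z μ ν
    simp only [Pi.sub_apply]
    rw [show Bt ⟨z.shift ν, μ⟩ - Pc ⟨z.shift ν, μ⟩ - (Bt ⟨z, μ⟩ - Pc ⟨z, μ⟩)
        = (Bt ⟨z.shift ν, μ⟩ - Bt ⟨z, μ⟩) - (Pc ⟨z.shift ν, μ⟩ - Pc ⟨z, μ⟩) by ring]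
    exact (abs_sub _ _).trans (add_le_add (hregBt z μ ν) (hδP z μ ν))
  have hregAB0 : ∀ (z : HiggsLattice.Site P 0) (μ ν : Fin P.d),
      |(A + B0) ⟨z.shift ν, μ⟩ - (A + B0) ⟨z, μ⟩| ≤ δB + s * (l + l) := by
    intro z μ ν
    simp only [Pi.add_apply]
    rw [hB0, show A ⟨z.shift ν, μ⟩ + B0 ⟨z, μ⟩ - (A ⟨z, μ⟩ + B0 ⟨z, μ⟩) = A ⟨z.shift ν, μ⟩ - A ⟨z, μ⟩ by ring]
    exact hδA z μ ν
  have hregB0 : ∀ (z : HiggsLattice.Site P 0) (μ ν : Fin P.d), |B0 ⟨z.shift ν, μ⟩ - B0 ⟨z, μ⟩| ≤ 0 := by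
    intro z μ ν; rw [hB0, sub_self, abs_zero]
  have hLk : (0 : ℝ) ≤ (P.L : ℝ) ^ k := pow_nonneg (Nat.cast_nonneg _) _
  have hsmB : (P.L : ℝ) ^ k * δB * |C.e| ≤ t₁ := by
    refine le_trans ?_ (hsm.trans (min_le_left _ _))
    exact mul_le_mul_of_nonneg_right (mul_le_mul_of_nonneg_left (le_add_of_nonneg_right hδP0) hLk) (abs_nonneg _)
  have hsmA : (P.L : ℝ) ^ k * (δB + s * (l + l)) * |C.e| ≤ t₂ := by
    refine le_trans ?_ (hsm.trans (min_le_right _ _))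
    exact mul_le_mul_of_nonneg_right (mul_le_mul_of_nonneg_left (le_add_of_nonneg_left hδB) hLk) (abs_nonneg _)
  -- the support conditions of the two members
  have hsupp : ∀ b : HiggsLattice.PBond P 0, Pc b ≠ 0 → ∀ x : HiggsLattice.Site P 0, Interior k K₀ Ω₂ x →
      R ≤ (HiggsLattice.Site.tdist x b.src : ℝ) := by
    intro b hb x hx
    obtain ⟨hb1, hb0⟩ := collar_support Bt B0 Pc χ ψ hPc hb
    exact hfar b.src hb1 hb0 x hx
  have hAS : ∀ b : HiggsLattice.PBond P 0, A b ≠ 0 → DeepBlk k K₀ (cellBox k K₀ S) b.src ∧ DeepBlk k K₀ (cellBox k K₀ S) b.tgt := by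
    intro b hb
    obtain ⟨hb1, hb0⟩ := core_support Bt B0 A χ ψ hA hb
    exact ⟨(hχdeep b.src hb1 hb0).1, (hχdeep b.src hb1 hb0).2 b.dir⟩
  have hagree : ∀ b : HiggsLattice.PBond P 0, b.src ∈ cellBox k K₀ S → (Bt - Pc) b = (A + B0) b :=
    fun b hb => sub_collar_eq_core_add Bt B0 Pc A χ ψ hPc hA (hψbox b.src hb).1
  have hak : 0 ≤ B1.aSeq a P.L k := (B1.aSeq_pos ha (by exact_mod_cast hP1) hk).le
  -- (o) locality: the two backgrounds agree on the bonds inside `□`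
  have hloc : ∀ u : ScalarField P 0 N, (∀ x, x ∉ cellBox k K₀ S → u x = 0) →
      propagatorK C (cellBox k K₀ S) (Bt - Pc) msq a k u = propagatorK C (cellBox k K₀ S) (A + B0) msq a k u :=
    fun u hu => propagatorK_congr_of_supported C hmsq hak (blockUnion_of_isBigBlockUnion le_rfl (isBigBlockUnion_cellBox S)) hkK
      (fun b hb => hagree b hb.1) u hu
  -- (o) recombination: the resolvent identity (I.3.44) in `P` around `B̃ − P`, then the two-sided expansion in `A` around `B̃₀`
  have hres : propagatorK C (cellBox k K₀ S) Bt msq a k =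
      propagatorK C (cellBox k K₀ S) (Bt - Pc) msq a k + op116 C (cellBox k K₀ S) Pc (Bt - Pc) msq a k 1 0 := by
    have h := eq344_model C (cellBox k K₀ S) Pc (Bt - Pc) a k hmsq hak
    rw [hPY] at h
    rw [op116_succ_left, op116_zero_zero, hPY]
    exact h
  refine ⟨⟨hagree, hloc, fun u hu => ?_⟩, ?_, fun {eR pR} h0 hle => ?_⟩
  · rw [hres, LinearMap.add_apply, hloc u hu, propagatorK_add_apply C (cellBox k K₀ S) A B0 a k hmsq hak n n' u]
  · -- (a) the collar member for `(P, B̃ − P)`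
    exact h1 P hP1 hPd hPL hK₀M hk hkK h3h hmesh S Ω₂ hΩ₂ hsub Pc (Bt - Pc) (δY := δB + (δB + s * (l + l))) (δPY := δB)
      (δP := δB + s * (l + l)) (s := s) (ρ := ρ) (R := R) hδY0 hδB hδP0 hs hρ (fun z _ μ ν => hregY z μ ν)
      (fun z _ μ ν => by rw [hPY]; exact hregBt z μ ν) hδP (hsm.trans (min_le_left _ _)) hsmB hsmc hPs hRfar hRnear hsupp r₀ i₀
  · -- (b) the region member R5 for `(A, B̃₀)` on `Ω = □`
    have h00 : (P.L : ℝ) ^ k * 0 * |C.e| ≤ t₂ := by rw [mul_zero, zero_mul]; exact ht₂.le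
    have h0c : (P.L : ℝ) ^ k * 0 ≤ c * |C.e| := by rw [mul_zero]; exact mul_nonneg hc (abs_nonneg _)
    exact h2 P hP1 hPd hPL hK₀M hk hkK h3h hmesh (cellBox k K₀ S) Ω₂ (isBigBlockUnion_cellBox S) hΩ₂ hsub A B0 (δB := 0)
      (δAB := δB + s * (l + l)) (δA := δB + s * (l + l)) (s := s) le_rfl hδP0 hδP0 hs (fun z _ μ ν => hregB0 z μ ν)
      (fun z _ μ ν => hregAB0 z μ ν) hδA h00 hsmA h0c hAs hsm1 hAS r₀ h0 hle i₀

end Main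

/-! ## §3 Both members from print's data and the two distance conditions alone -/

section OfDist

/-- **[B3] p. 433 class (c) BY THE CELL'S ROUTE δ, FROM PRINT'S DATA ON `□` AND TWO DISTANCE CONDITIONS** — §2 with the cutoffs SUPPLIED
by `B3Op116ClassCCutoffs.exists_cutoffs`: for fixed orders `n, n′ ≥ 1`, `n + n′ > d`, under one charge threshold and one cube size, for every box `□ = cellBox k K₀ S`, nonempty
big-block union `Ω₂ ⊆ □`, background `B̃` ((I.2.23)-regular, `δ_B`), shift-invariant `B̃₀` with `|B̃ − B̃₀| ≤ s` within lattice distance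
`R₂ + ℓ` of `Ω₂` (print: *"|B̃ − B̃₀| ≤ O(r(L^kε)p(L^kε)) ≤ O(p(L^kε)²) on the cube □"*), cutoff length `ℓ > 0`, provided every site within distance
`R + ℓ + 1` of `Ω₂` is deep in `□` and every site of `□` is within distance `R₂ − 1` of `Ω₂` (print's concentric cubes), `ρL^k + L^k ≤ R`,
`dL^k < R`, `ρ ≥ 1`, in the regime `L^k(2δ_B + 2s/ℓ)|e| ≤ t`, `L^k(2δ_B + 2s/ℓ) ≤ c|e|`, `(L^kε)|e|s ≤ 1`: THERE ARE cutoffs `χ, ψ` and the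
pieces `P = B̃′(1−χ)ψ`, `A = B̃′χψ` with (o) `B̃ − P = A + B̃₀` on the bonds from `□`, `G_k(□,B̃ − P)u = G_k(□,A + B̃₀)u` and the undivided
sum `G_k(□,B̃)u = Σ_{j<n+n′} G_k(□,B̃₀)[V_k(A,B̃₀)G_k(□,B̃₀)]^j u + (1.16)^□_{n,n′}(A,B̃₀)u + (1.16)^□_{1,0}(P,B̃−P)u` for sources in `□`,
(a) the collar member for `(P, B̃ − P)` at `(1,0)/(0,1)` and (b) the region member for `(A, B̃₀)` at `(n,n′)`, as in `ineq25At_classC_split`.  Recorded route deviation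
G-B3-16.A1; no head claim. [cite: Balaban1983Higgs3, p.433 l.5–15, (2.5) p.424, (1.16) p.414, p.412] [cite: Balaban1982Higgs1, Prop. 2.1 (2.23)-(2.25) p.610, (1.3) p.604] [cite: Balaban1983RegularityDecay, Theorem p.573] -/
theorem ineq25At_classC_split_of_dist (d L : ℕ) (hd : 1 ≤ d) (hL : 2 ≤ L) {a : ℝ} (ha : 0 < a) {msq : ℝ} (hmsq : 0 < msq)
    {c : ℝ} (hc : 0 ≤ c) (N m : ℕ) {c₁ c₂ : ℝ} (hc₁ : 0 ≤ c₁) (hc₂ : 0 ≤ c₂)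
    (n n' : ℕ) (hn : 1 ≤ n) (hn' : 1 ≤ n') (hdn : d < n + n') :
    ∃ E₀ : ℝ, 0 < E₀ ∧ ∀ (C : ChargeData N), C.e ^ 2 ≤ E₀ →
      ∃ K₀min : ℕ, ∀ {α : ℝ}, 0 ≤ α → α < 1 → ∀ K₀ : ℕ, K₀min ≤ K₀ →
      ∃ t δ δ₀ CG C₁ C₂ C₄ δ₁ δ₀' Cst CM CH CG' : ℝ, 0 < t ∧ 0 < δ ∧ δ ≤ 1 ∧ 0 < δ₀ ∧ 0 ≤ CG ∧ 0 ≤ C₁ ∧ 0 ≤ C₂ ∧ 0 ≤ C₄ ∧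
          0 < δ₁ ∧ δ₁ ≤ 1 ∧ 0 < δ₀' ∧ 0 ≤ Cst ∧ 0 ≤ CM ∧ 0 ≤ CH ∧ 0 ≤ CG' ∧
      ∀ (P : HiggsLattice.Params) (hP1 : 1 < P.L), P.d = d → P.L = L → K₀ ∣ P.M →
      ∀ {k : ℕ}, 1 ≤ k → k ≤ P.K → (∀ μ, 3 * half P k K₀ ≤ P.sitesPerDir 0 μ) → P.mesh k ≤ 1 →
      ∀ (S : Fin P.d → Finset ℕ) (Ω₂ : Finset (HiggsLattice.Site P 0)), Ω₂.Nonempty → IsBigBlockUnion k K₀ Ω₂ → Ω₂ ⊆ cellBox k K₀ S →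
      ∀ (Bt B0 : HiggsLattice.VecField P 0) {δB s ℓ ρ R R₂ : ℝ}, 0 ≤ δB → 0 ≤ s → 0 < ℓ → 1 ≤ ρ →
        (∀ (z : HiggsLattice.Site P 0) (μ ν : Fin P.d), B0 ⟨z.shift ν, μ⟩ = B0 ⟨z, μ⟩) →
        (∀ (z : HiggsLattice.Site P 0) (μ ν : Fin P.d), |Bt ⟨z.shift ν, μ⟩ - Bt ⟨z, μ⟩| ≤ δB) →
        (∀ (z : HiggsLattice.Site P 0) (μ : Fin P.d), (∃ y ∈ Ω₂, (HiggsLattice.Site.tdist y z : ℝ) < R₂ + ℓ) →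
          |Bt ⟨z, μ⟩ - B0 ⟨z, μ⟩| ≤ s) →
        (∀ (z y : HiggsLattice.Site P 0), y ∈ Ω₂ → (HiggsLattice.Site.tdist y z : ℝ) ≤ R + ℓ + 1 → DeepBlk k K₀ (cellBox k K₀ S) z) →
        (∀ z ∈ cellBox k K₀ S, ∃ y ∈ Ω₂, (HiggsLattice.Site.tdist y z : ℝ) + 1 ≤ R₂) →
        ρ * (P.L : ℝ) ^ k + (P.L : ℝ) ^ k ≤ R → (P.d : ℝ) * (P.L : ℝ) ^ k < R →
        (P.L : ℝ) ^ k * (δB + (δB + s * (ℓ⁻¹ + ℓ⁻¹))) * |C.e| ≤ t → (P.L : ℝ) ^ k * (δB + (δB + s * (ℓ⁻¹ + ℓ⁻¹))) ≤ c * |C.e| →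
        P.mesh k * (|C.e| * s) ≤ 1 →
      ∀ r₀ : ℕ, Ix N →
        ∃ (χ ψ : HiggsLattice.Site P 0 → ℝ) (Pc A : HiggsLattice.VecField P 0),
          (∀ b : HiggsLattice.PBond P 0, Pc b = (Bt b - B0 b) * ((1 - χ b.src) * ψ b.src)) ∧
          (∀ b : HiggsLattice.PBond P 0, A b = (Bt b - B0 b) * (χ b.src * ψ b.src)) ∧
        ((∀ b : HiggsLattice.PBond P 0, b.src ∈ cellBox k K₀ S → (Bt - Pc) b = (A + B0) b) ∧
          (∀ u : ScalarField P 0 N, (∀ x, x ∉ cellBox k K₀ S → u x = 0) →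
            propagatorK C (cellBox k K₀ S) (Bt - Pc) msq a k u = propagatorK C (cellBox k K₀ S) (A + B0) msq a k u) ∧
          (∀ u : ScalarField P 0 N, (∀ x, x ∉ cellBox k K₀ S → u x = 0) →
            propagatorK C (cellBox k K₀ S) Bt msq a k u =
              (∑ j ∈ Finset.range (n + n'), (propagatorK C (cellBox k K₀ S) B0 msq a k *
                  (opV C (cellBox k K₀ S) A B0 msq a k * propagatorK C (cellBox k K₀ S) B0 msq a k) ^ j) u)
                + op116 C (cellBox k K₀ S) A B0 msq a k n n' u + op116 C (cellBox k K₀ S) Pc (Bt - Pc) msq a k 1 0 u)) ∧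
        ((sect2Smooth116 hP1 C (cellBox k K₀ S) Ω₂ Pc (Bt - Pc) msq a k K₀ r₀ m c₁ c₂ (P.mesh k) 1).Ineq25At 1 0 α (min δ₀ (δ / 4))
            (CG + (P.mesh 0 ^ P.d)⁻¹ * farF P δ ρ *
              collarK P N C k a δ α s (δB + s * (ℓ⁻¹ + ℓ⁻¹)) (P.mesh 0 ^ P.d * C₁) (P.mesh 0 ^ P.d * C₁)
                (P.mesh 0 ^ P.d * C₂) (P.mesh 0 ^ P.d * C₁) (P.mesh 0 ^ P.d * C₁) (P.mesh 0 ^ P.d * C₂) (P.mesh 0 ^ P.d * C₄)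
                (P.mesh 0 ^ P.d * C₄) (faces k K₀ S).card m c₁ c₂) ∧
          (sect2Smooth116 hP1 C (cellBox k K₀ S) Ω₂ Pc (Bt - Pc) msq a k K₀ r₀ m c₁ c₂ (P.mesh k) 1).Ineq25At 0 1 α (min δ₀ (δ / 4))
            (CG + (P.mesh 0 ^ P.d)⁻¹ * farF P δ ρ *
              collarK P N C k a δ α s (δB + s * (ℓ⁻¹ + ℓ⁻¹)) (P.mesh 0 ^ P.d * C₁) (P.mesh 0 ^ P.d * C₁)
                (P.mesh 0 ^ P.d * C₂) (P.mesh 0 ^ P.d * C₁) (P.mesh 0 ^ P.d * C₁) (P.mesh 0 ^ P.d * C₂) (P.mesh 0 ^ P.d * C₄)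
                (P.mesh 0 ^ P.d * C₄) (faces k K₀ S).card m c₁ c₂)) ∧
        (∀ {eR pR : ℝ}, 0 ≤ eR * pR → P.mesh k ≤ eR * pR →
          (sect2Smooth116 hP1 C (cellBox k K₀ S) Ω₂ A B0 msq a k K₀ r₀ m c₁ c₂ eR pR).Ineq25At n n' α
            (min δ₀' (δ₁ / (4 * (P.L : ℝ)) ^ (n + n' + 1)))
            (CG' + (smoothConst P.d m c₁ (c₂ + 2 * c₁) *
                (valC P N C k a δ₁ Cst s (δB + s * (ℓ⁻¹ + ℓ⁻¹)) (n + n') + derC P N C k a δ₁ Cst s (δB + s * (ℓ⁻¹ + ℓ⁻¹)) (n + n'))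
              + (holC P N C k a δ₁ Cst s (δB + s * (ℓ⁻¹ + ℓ⁻¹)) α (P.mesh 0 ^ P.d * CH) (n + n' - 1)
                + P.d * m * mixC P N C k a δ₁ Cst CM s (δB + s * (ℓ⁻¹ + ℓ⁻¹)) (n + n'))))) := by
  obtain ⟨E₀, hE₀, hG⟩ := ineq25At_classC_split d L hd hL ha hmsq hc N m hc₁ hc₂ n n' hn hn' hdn
  refine ⟨E₀, hE₀, fun C heC => ?_⟩
  obtain ⟨K₀min, hK⟩ := hG C heC
  refine ⟨K₀min, fun {α} hα0 hα1 K₀ hK₀ => ?_⟩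
  obtain ⟨t, δ, δ₀, CG, C₁, C₂, C₄, δ₁, δ₀', Cst, CM, CH, CG', ht, hδ, hδ1, hδ₀, hCG, hC₁, hC₂, hC₄, hδ₁, hδ₁1, hδ₀', hCst, hCM,
    hCH, hCG', h⟩ := hK hα0 hα1 K₀ hK₀
  refine ⟨t, δ, δ₀, CG, C₁, C₂, C₄, δ₁, δ₀', Cst, CM, CH, CG', ht, hδ, hδ1, hδ₀, hCG, hC₁, hC₂, hC₄, hδ₁, hδ₁1, hδ₀', hCst, hCM, hCH,
    hCG', ?_⟩
  intro P hP1 hPd hPL hK₀M k hk hkK h3h hmesh S Ω₂ hne hΩ₂ hsub Bt B0 δB s ℓ ρ R R₂ hδB hs hℓ hρ hB0 hregBt hsz hdeep hbox hRfar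
    hRnear hsm hsmc hsm1 r₀ i₀
  obtain ⟨χ, ψ, hχ01, hψ01, hχ, hψ, hψbox, hχdeep, hfar, hψnear⟩ := exists_cutoffs S hne (R := R) (R₂ := R₂) hℓ hdeep hbox
  exact ⟨χ, ψ, fun b => (Bt b - B0 b) * ((1 - χ b.src) * ψ b.src), fun b => (Bt b - B0 b) * (χ b.src * ψ b.src), fun b => rfl,
    fun b => rfl, h P hP1 hPd hPL hK₀M hk hkK h3h hmesh S Ω₂ hΩ₂ hsub Bt B0 χ ψ hδB hs (inv_pos.2 hℓ).le hρ hB0 hregBt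
      (fun z μ hz => hsz z μ (hψnear z hz)) hχ01 hψ01 hχ hψ hψbox hχdeep hfar hRfar hRnear hsm hsmc hsm1 _ _
      (fun b => rfl) (fun b => rfl) r₀ i₀⟩

end OfDist

end Literature.MathematicalPhysics.QuantumFieldTheory.Balaban1983to89.B3Ineq25Op116ClassCSplit

end
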